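import Summits.CriticalPhenomena.PercolationContinuityZ3.Theses.PercNearOneGluing
import Literature.Probability.Percolation.PercolationEvents
import HarnessLib.Audit
import Literature.Probability.LatticeModels.ProdBernoulliIndependence
import Literature.Probability.LatticeModels.ProdBernoulliCoupling

/-! TTRL-lite variant V2374 of stmt-CriticalPhenomena-4574

(`stub_shorteningStep` of line `kn_shortening_induction`, move `small_case`: `n ≤ 3`).  On at most
three vertices the Kozma–Nitzan shortening step (Conjecture 6 with the induction hypothesis
displayed) is elementary: under `w[s(v,x) ↦ 1]` the glued pair is open almost surely
(`prodBernoulli_real_setOf_notMem`), so `P'(x ↔ z) ≤ P'(v ↔ z)` for every `z`; the cases `b = v`,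
`a₀ = x`, `b = x` are then immediate, the case `b = a₀` uses the minimiser hypothesis (if `x ∈ A` it
forces `P_w(x ↔ a₀) = 1`, transported to the glued weights by monotonicity in the weights
`prodBernoulli_real_mono_of_isUpperSet`; if `x ∉ A` then `A = {a₀}` by counting), and otherwise
`v, x, a₀, b` would be four distinct elements of `Fin n`, `n ≤ 3`.  The induction hypothesis is not
used.  No new definitions, no named facts. -/

namespace Summit.CriticalPhenomena.PercolationContinuityZ3.Theorems

open MeasureTheory Set Literature.Probability.LatticeModels Literature.Probability.Percolation
open scoped Classical BigOperators

/-- TTRL-lite variant V2374 of `stub_shorteningStep` (stmt-CriticalPhenomena-4574, Kozma–Nitzan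
Conjecture 6 with induction hypothesis): the shortening step on at most three vertices.  With
`μ = prodBernoulli (w[s(v,x) ↦ 1])` the pair `s(v,x)` is `μ`-a.s. open, whence
`μ(x ↔ z) ≤ μ(v ↔ z)`; a case analysis on `b ∈ {v, x, a₀}` (forced by `n ≤ 3`) and on `x ∈ A`
(where the minimiser hypothesis gives `P_w(x ↔ a₀) = 1`) concludes. -/
theorem stub_shorteningStep_var2374 : ∀ (n : ℕ) (w : Sym2 (Fin n) → unitInterval) (A : Finset (Fin n)) (b v x a₀ : Fin n), n ≤ 3 → v ∉ A → v ≠ x → w s(v, x) = 0 → a₀ ∈ A → (∀ a ∈ A, (prodBernoulli w).real (openConn a₀ b) ≤ (prodBernoulli w).real (openConn a b)) → (∀ w' : Sym2 (Fin n) → unitInterval, (∀ e, w e = 0 → w' e = 0) → ∀ (A' : Finset (Fin n)) (o' b' : Fin n) (t : ℝ), (∀ a ∈ A', t ≤ (prodBernoulli w').real (openConn a b')) → (prodBernoulli w').real (⋃ a ∈ A', openConn o' a) * t ≤ (prodBernoulli w').real (openConn o' b')) → (prodBernoulli (Function.update w s(v, x) 1)).real (⋃ a ∈ A, openConn v a)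 * (prodBernoulli (Function.update w s(v, x) 1)).real (openConn a₀ b) ≤ (prodBernoulli (Function.update w s(v, x) 1)).real (openConn v b) := by
  intro n w A b v x a₀ hn hvA hvx _hw0 ha₀ hmin _hIH
  -- basic bounds on the two factors
  have hY0 : 0 ≤ (prodBernoulli (Function.update w s(v, x) 1)).real (⋃ a ∈ A, openConn v a) :=
    measureReal_nonneg
  have hY1 : (prodBernoulli (Function.update w s(v, x) 1)).real (⋃ a ∈ A, openConn v a) ≤ 1 :=
    measureReal_le_one
  have hZ0 : 0 ≤ (prodBernoulli (Function.update w s(v, x) 1)).real (openConn a₀ b) :=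
    measureReal_nonneg
  have hZ1 : (prodBernoulli (Function.update w s(v, x) 1)).real (openConn a₀ b) ≤ 1 :=
    measureReal_le_one
  -- the product is at most each factor, and at most `1`
  have hLY : (prodBernoulli (Function.update w s(v, x) 1)).real (⋃ a ∈ A, openConn v a) *
      (prodBernoulli (Function.update w s(v, x) 1)).real (openConn a₀ b) ≤
      (prodBernoulli (Function.update w s(v, x) 1)).real (⋃ a ∈ A, openConn v a) :=
    mul_le_of_le_one_right hY0 hZ1
  have hLZ : (prodBernoulli (Function.update w s(v, x) 1)).real (⋃ a ∈ A, openConn v a) *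
      (prodBernoulli (Function.update w s(v, x) 1)).real (openConn a₀ b) ≤
      (prodBernoulli (Function.update w s(v, x) 1)).real (openConn a₀ b) :=
    mul_le_of_le_one_left hZ0 hY1
  have hL1 : (prodBernoulli (Function.update w s(v, x) 1)).real (⋃ a ∈ A, openConn v a) *
      (prodBernoulli (Function.update w s(v, x) 1)).real (openConn a₀ b) ≤ 1 := hLY.trans hY1
  -- the glued pair is closed with probability `0`
  have hclosed : (prodBernoulli (Function.update w s(v, x) 1)).real
      {ω : BondConfig (Fin n) | s(v, x) ∉ ω} = 0 := by
    rw [prodBernoulli_real_setOf_notMem, Function.update_self]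
    simp
  -- transfer: if `E ∩ {s(v,x) open} ⊆ F` then `μ E ≤ μ F`
  have htransfer : ∀ E F : Set (BondConfig (Fin n)), (∀ ω ∈ E, s(v, x) ∈ ω → ω ∈ F) →
      (prodBernoulli (Function.update w s(v, x) 1)).real E ≤
        (prodBernoulli (Function.update w s(v, x) 1)).real F := by
    intro E F hEF
    have hsub : E ⊆ F ∪ {ω : BondConfig (Fin n) | s(v, x) ∉ ω} := by
      intro ω hω
      by_cases h : s(v, x) ∈ ω
      · exact Or.inl (hEF ω hω h)
      · exact Or.inr h
    calc (prodBernoulli (Function.update w s(v, x) 1)).real E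
        ≤ (prodBernoulli (Function.update w s(v, x) 1)).real
            (F ∪ {ω : BondConfig (Fin n) | s(v, x) ∉ ω}) := measureReal_mono hsub
      _ ≤ (prodBernoulli (Function.update w s(v, x) 1)).real F +
            (prodBernoulli (Function.update w s(v, x) 1)).real
              {ω : BondConfig (Fin n) | s(v, x) ∉ ω} := measureReal_union_le _ _
      _ = (prodBernoulli (Function.update w s(v, x) 1)).real F := by rw [hclosed, add_zero]
  -- F1: `μ(x ↔ z) ≤ μ(v ↔ z)`
  have hF1 : ∀ z : Fin n, (prodBernoulli (Function.update w s(v, x) 1)).real (openConn x z) ≤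
      (prodBernoulli (Function.update w s(v, x) 1)).real (openConn v z) := by
    intro z
    refine htransfer _ _ fun ω hω hvxω => ?_
    have hadj : (openGraph ω).Adj v x := (openGraph_adj ω v x).2 ⟨hvxω, hvx⟩
    exact hadj.reachable.trans hω
  -- `{z ↔ z}` is the sure event
  have hrefl : ∀ (p : Sym2 (Fin n) → unitInterval) (z : Fin n),
      (prodBernoulli p).real (openConn z z) = 1 := by
    intro p z
    have : (openConn z z : Set (BondConfig (Fin n))) = Set.univ := by
      ext ω; exact ⟨fun _ => trivial, fun _ => SimpleGraph.Reachable.refl z⟩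
    rw [this]; exact probReal_univ
  -- case `b = v`
  by_cases hbv : b = v
  · subst hbv
    rw [hrefl]; exact hL1
  -- case `a₀ = x`
  by_cases ha₀x : a₀ = x
  · subst ha₀x
    exact hLZ.trans (hF1 b)
  have ha₀v : a₀ ≠ v := fun h => hvA (h ▸ ha₀)
  -- case `b = x`
  by_cases hbx : b = x
  · subst hbx
    have h1 : 1 ≤ (prodBernoulli (Function.update w s(v, b) 1)).real (openConn v b) := by
      have := hF1 b
      rwa [hrefl] at this
    exact hL1.trans h1
  -- case `b = a₀`
  by_cases hba : b = a₀
  · subst hba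
    by_cases hxA : x ∈ A
    · -- the minimiser hypothesis forces `P_w(x ↔ b) = 1`
      have hm := hmin x hxA
      rw [hrefl] at hm
      have hwx1 : (prodBernoulli w).real (openConn x b) = 1 := le_antisymm measureReal_le_one hm
      -- monotonicity in the weights transports it to the glued weights
      have hle : w ≤ Function.update w s(v, x) 1 := by
        intro e
        by_cases he : e = s(v, x)
        · subst he; rw [Function.update_self]; exact unitInterval.le_one _
        · rw [Function.update_of_ne he]
      have hmono := prodBernoulli_real_mono_of_isUpperSet hle (isUpperSet_openConn x b)
        (Set.toFinite _).measurableSet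
      rw [hwx1] at hmono
      exact hL1.trans (hmono.trans (hF1 b))
    · -- `x ∉ A`: every relay equals `b`
      have hAsub : ∀ a ∈ A, a = b := by
        intro a ha
        have hav : a ≠ v := fun h => hvA (h ▸ ha)
        have hax : a ≠ x := fun h => hxA (h ▸ ha)
        by_contra hab
        have h2 : ({b, a} : Finset (Fin n)).card = 2 := Finset.card_pair (fun h => hab h.symm)
        have h3 : x ∉ ({b, a} : Finset (Fin n)) := by
          simp only [Finset.mem_insert, Finset.mem_singleton, not_or]
          exact ⟨fun h => hbx h.symm, fun h => hax h.symm⟩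
        have h4 : v ∉ ({x, b, a} : Finset (Fin n)) := by
          simp only [Finset.mem_insert, Finset.mem_singleton, not_or]
          exact ⟨hvx, fun h => hbv h.symm, fun h => hav h.symm⟩
        have hcard : ({v, x, b, a} : Finset (Fin n)).card ≤ n := by
          calc ({v, x, b, a} : Finset (Fin n)).card ≤ Fintype.card (Fin n) := Finset.card_le_univ _
            _ = n := Fintype.card_fin n
        rw [Finset.card_insert_of_notMem h4, Finset.card_insert_of_notMem h3, h2] at hcard
        omega
      have hU : (⋃ a ∈ A, openConn v a : Set (BondConfig (Fin n))) ⊆ openConn v b := by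
        intro ω hω
        simp only [mem_iUnion, exists_prop] at hω
        obtain ⟨a, ha, h⟩ := hω
        rwa [hAsub a ha] at h
      exact hLY.trans (measureReal_mono hU)
  -- otherwise `v, x, a₀, b` are four distinct elements of `Fin n`, `n ≤ 3`
  exfalso
  have h2 : ({a₀, b} : Finset (Fin n)).card = 2 := Finset.card_pair (fun h => hba h.symm)
  have h3 : x ∉ ({a₀, b} : Finset (Fin n)) := by
    simp only [Finset.mem_insert, Finset.mem_singleton, not_or]
    exact ⟨fun h => ha₀x h.symm, fun h => hbx h.symm⟩
  have h4 : v ∉ ({x, a₀, b} : Finset (Fin n)) := by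
    simp only [Finset.mem_insert, Finset.mem_singleton, not_or]
    exact ⟨hvx, fun h => ha₀v h.symm, fun h => hbv h.symm⟩
  have hcard : ({v, x, a₀, b} : Finset (Fin n)).card ≤ n := by
    calc ({v, x, a₀, b} : Finset (Fin n)).card ≤ Fintype.card (Fin n) := Finset.card_le_univ _
      _ = n := Fintype.card_fin n
  rw [Finset.card_insert_of_notMem h4, Finset.card_insert_of_notMem h3, h2] at hcard
  omega

end Summit.CriticalPhenomena.PercolationContinuityZ3.Theorems
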